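import Mathlib
import Summits.Schanuel.Schanuel.Theses.RigidCore
import Literature.NumberTheory.Transcendental.RoyCriterionProofs
import Literature.NumberTheory.Transcendental.RoySmallValueEstimates

/-!
# Sketch — crux-ideate stmt-Schanuel-0970 (ideator 4, round 2): card `kernel-helix-roy-criterion`

First-lemma signatures for the idea card. Everything is a `def … : Prop` (statements only) except
two bookkeeping lemmas proved outright. Namespace per the crux protocol.
-/

noncomputable section

open Complex MvPolynomial Filter
open Literature.NumberTheory.Transcendental

namespace Summit.Schanuel.Schanuel.Cruxes.SchanuelOnLogFreeCore.KernelHelix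

/-- The log-free core `C_EA`, verbatim the crux's `sInf`. -/
def core : IntermediateField ℚ ℂ :=
  sInf {K : IntermediateField ℚ ℂ | (2 * ↑Real.pi * Complex.I : ℂ) ∈ K ∧
    (∀ w ∈ K, Complex.exp w ∈ K) ∧ ∀ w : ℂ, IsAlgebraic K w → w ∈ K}

/-- The kernel generator `τ = 2πi`. -/
abbrev τ : ℂ := 2 * ↑Real.pi * Complex.I

/-- The crux, unfolded (definitional check that we talk about the route decl). -/
theorem crux_iff :
    Summit.Schanuel.Schanuel.Theses.RigidCore.SchanuelOnLogFreeCore ↔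
      ∀ (n : ℕ) (x : Fin n → ℂ), (∀ i, x i ∈ core) → LinearIndependent ℚ x →
        (n : Cardinal) ≤ Algebra.trdeg ℚ
          ↥(IntermediateField.adjoin ℚ (Set.range x ∪ Set.range (Complex.exp ∘ x))) :=
  Iff.rfl

/-- **KRC(2)** — Roy's Conjecture 2 (Roy 2001) at `l = 2` with the second generator PINNED at
the kernel point `(y₂, α₂) = (2πi, 1)`: the "kernel sector" of `RoyCriterion 2`. The point set of
the hypothesis is `{(m₁ y₁ + m₂·2πi, α₁^{m₁})}` = period-lattice samples of the `D`-orbits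
`t ↦ (m₁y₁ + t, α₁^{m₁} e^t)` (orbit lemma below). -/
def KernelRoyCriterionTwo : Prop :=
  ∀ (y₁ α₁ : ℂ), LinearIndependent ℚ ![y₁, τ] → α₁ ≠ 0 →
    ∀ (s₀ s₁ t₀ t₁ u : ℝ), RoyAdmissible s₀ s₁ t₀ t₁ u →
      RoyHypothesis ![y₁, τ] ![α₁, 1] s₀ s₁ t₀ t₁ u →
        (2 : Cardinal) ≤ Algebra.trdeg ℚ
          ↥(IntermediateField.adjoin ℚ (Set.range ![y₁, τ] ∪ Set.range ![α₁, (1 : ℂ)]))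

/-- **Schanuel 1½** — Schanuel's conjecture at rank 2 for pairs through the kernel generator:
`(y₁, 2πi)` ℚ-free ⇒ `trdeg ℚ(y₁, 2πi, e^{y₁}) ≥ 2`. Strictly between `SchanuelRank 1`
(Hermite–Lindemann, proved) and `SchanuelRank 2`. Contains `e ⊥ π` (`y₁ = 1`), `e^{π²} ∉ ℚ(π)^alg`
(`y₁ = π²`), `π ⊥ e^i`, `π ⊥ (−1)^{√2}`, `π ⊥ log 2` (`y₁ = log 2`). -/
def KernelPairsSchanuel : Prop :=
  ∀ y₁ : ℂ, LinearIndependent ℚ ![y₁, τ] →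
    (2 : Cardinal) ≤ Algebra.trdeg ℚ
      ↥(IntermediateField.adjoin ℚ (Set.range ![y₁, τ] ∪ Set.range (cexp ∘ ![y₁, τ])))

/-- FIRST LEMMA (a): the transfer is EXACT — `KRC(2) ↔ Schanuel 1½` (→ by Roy's Thm 3 in the
corrected form `Roy2001_thm3'_holds` / `royHypothesis_exp'`; ← by Roy's Thm 1 `Roy2001_thm1`
(Prop. 2 + Prop. 3), exactly as in `Roy2001_iff_holds`, sector by sector). -/
def FirstLemma_transfer : Prop := KernelRoyCriterionTwo ↔ KernelPairsSchanuel

/-- FIRST LEMMA (b): the sandwich `SchanuelRank 2 → KRC(2) → SchanuelRank 1`. -/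
def FirstLemma_sandwich : Prop :=
  (SchanuelRank 2 → KernelRoyCriterionTwo) ∧ (KernelRoyCriterionTwo → SchanuelRank 1)

/-- `KRC(2)` is a literal restriction of `RoyCriterion 2` (proved here: bookkeeping). -/
theorem krc_of_royCriterion_two (h : RoyCriterion 2) : KernelRoyCriterionTwo := by
  intro y₁ α₁ hli hα s₀ s₁ t₀ t₁ u hadm hhyp
  refine h ![y₁, τ] ![α₁, 1] hli ?_ s₀ s₁ t₀ t₁ u hadm hhyp
  intro j
  fin_cases j
  · simpa using hα
  · simp

/-- FIRST LEMMA (c): `Schanuel 1½` gives the crux's rank-2 KERNEL SECTOR (core pairs whose ℚ-span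
contains `2πi`): `GL₂(ℚ)` bookkeeping. Residue named: the kernel-free core pairs (`(1, e)`: `e ⊥ e^e`)
and ranks `≥ 3` are NOT covered by KRC(2) (they are by KRC(3) = the kernel sector of RoyCriterion 3). -/
def FirstLemma_kernelSector : Prop :=
  KernelPairsSchanuel →
    ∀ x : Fin 2 → ℂ, (∀ i, x i ∈ core) → LinearIndependent ℚ x →
      (τ : ℂ) ∈ Submodule.span ℚ (Set.range x) →
        (2 : Cardinal) ≤ Algebra.trdeg ℚ
          ↥(IntermediateField.adjoin ℚ (Set.range x ∪ Set.range (cexp ∘ x)))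

/-- Residue made explicit (O1 of the triage): `Schanuel 1½` already contains `e ⊥ π`. -/
def Residue_expOnePi : Prop :=
  KernelPairsSchanuel → Literature.NumberTheory.Transcendental.ExpOnePiAlgebraicIndependent

/-- ORBIT LEMMA (the lever, elementary): Roy's derivation `D = ∂₀ + X₁∂₁` is the derivative along
the curves `t ↦ (ξ + t, η e^t)`, and the kernel translates `(ξ + 2πi m, η)` are the period-lattice
points of ONE such curve (`η e^{2πi m} = η`). Cf. tree `deriv_expEval` (the case `ξ = 0, η = 1`). -/
def OrbitLemma : Prop :=
  ∀ (P : MvPolynomial (Fin 2) ℤ) (ξ η : ℂ) (k : ℕ) (m : ℤ),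
    aeval ![ξ + τ * m, η] (royD^[k] P) =
      iteratedDeriv k (fun t : ℂ => aeval ![ξ + t, η * cexp t] P) (τ * m)

/-- **PSVE** (FIRST LEMMA (d), provable now from `GelfondCriterion_holds`): periodic sampling along
the kernel lattice with `D`-jets of order `≤ D` is IMPOSSIBLE above `ν = 1 + β` (`σ ≥ 1`):
Vandermonde in `m` (the `Y`-coordinate is FIXED along the period translates, so
`m ↦ 𝒟ⁱP(ξ + 2πi m, η)` is a polynomial of degree `≤ D`) ⇒ every `X`-coefficient `q(η)` of every
`𝒟ⁱP_D(·, η)` is `≤ e^{−D^ν + O(D log D)}` ⇒ Gel'fond's criterion / Liouville ⇒ `η ∈ ℚ̄` and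
`minpoly η ∣ 𝒟ⁱP_D` for all `i ≤ D` ⇒ contradiction with `𝒟(m^k Q) = m^{k-1}(m 𝒟Q + k Y m' Q)`,
`m ∤ k Y m' Q`. Dirichlet edge for this data shape: `ν = 1 + β − σ`; the periodic gap has width `σ`. -/
def PeriodicSmallValueEstimate : Prop :=
  ∀ (ξ η : ℂ), η ≠ 0 → ∀ (β σ ν : ℝ), 0 < β → 1 ≤ σ → 1 + β < ν →
    ¬ (∀ᶠ D : ℕ in atTop, ∃ P : MvPolynomial (Fin 2) ℤ, P ≠ 0 ∧ P.totalDegree ≤ D ∧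
        (mvPolyHeight P : ℝ) ≤ Real.exp ((D : ℝ) ^ β) ∧
        ∀ (i m : ℕ), i ≤ D → (m : ℝ) ≤ (D : ℝ) ^ σ →
          ‖aeval ![ξ + τ * m, η] (royD^[i] P)‖ ≤ Real.exp (-(D : ℝ) ^ ν))

/-- The PERIODIC DIRICHLET EDGE (provable by the box principle, mirrors the RoyCriterion route's
`Negative/DirichletEdge.lean`): with FEWER period translates than the degree (`σ < 1`) and below
`ν = 1 + β − σ`, the periodic hypothesis holds at EVERY point (unknowns `~D²/2` beat the
`~D^{1+σ}` conditions). For `σ ≥ 1` the box principle gives nothing (conditions ≥ unknowns) — the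
saturated regime of `PeriodicSmallValueEstimate`. -/
def PeriodicDirichletEdge : Prop :=
  ∀ (ξ η : ℂ), ∀ (β σ ν : ℝ), 0 ≤ σ → σ < 1 → 1 < β → 0 < ν → ν < 1 + β - σ →
    ∀ᶠ D : ℕ in atTop, ∃ P : MvPolynomial (Fin 2) ℤ, P ≠ 0 ∧ P.totalDegree ≤ D ∧
        (mvPolyHeight P : ℝ) ≤ Real.exp ((D : ℝ) ^ β) ∧
        ∀ (i m : ℕ), i ≤ D → (m : ℝ) ≤ (D : ℝ) ^ σ →
          ‖aeval ![ξ + τ * m, η] (royD^[i] P)‖ ≤ Real.exp (-(D : ℝ) ^ ν)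

/-- The OPEN periodic rung (the card's measurable target, a QUESTION not a claim): for `0 < σ < 1`
(the regime of the kernel-only shadow of KRC(2): `σ = s₁/t₀ < 1` in Roy's window, and Roy 2013's
closing remark `τ + sσ < 2` applies with `τ = 1`, `s = 1`) push nonexistence down towards the
periodic Dirichlet edge `ν = 1 + β − σ`; the realistic first goal is a Roy-2013-type threshold
`ν > 1 + β − σ + (gap term)`. -/
def PeriodicGap : Prop :=
  ∀ (ξ η : ℂ), η ≠ 0 → ∀ (β σ ν : ℝ), 0 < σ → σ < 1 → 1 < β → 1 + β - σ < ν →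
    ¬ (∀ᶠ D : ℕ in atTop, ∃ P : MvPolynomial (Fin 2) ℤ, P ≠ 0 ∧ P.totalDegree ≤ D ∧
        (mvPolyHeight P : ℝ) ≤ Real.exp ((D : ℝ) ^ β) ∧
        ∀ (i m : ℕ), i ≤ D → (m : ℝ) ≤ (D : ℝ) ^ σ →
          ‖aeval ![ξ + τ * m, η] (royD^[i] P)‖ ≤ Real.exp (-(D : ℝ) ^ ν))

/-- CALIBRATION AT THE KERNEL POINT (one-liners from PROVED tree facts + `transcendental_pi`):
Roy 2013 Thm 1.1 at `(ξ, η) = (2πi, 1)` — its conclusion `2πi ∈ ℚ̄` is false, so in Roy's window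
NO sequence of integer polynomials has small `D`-jets at the kernel point. -/
def Roy2013AtKernelPoint : Prop :=
  ∀ (β τ' ν : ℝ), 1 ≤ τ' → τ' < 2 → τ' < β →
    2 + β - τ' + (τ' - 1) * (2 - τ') / (β + 1 - τ') < ν →
    ¬ (∀ᶠ D : ℕ in atTop, ∃ P : MvPolynomial (Fin 2) ℤ, P ≠ 0 ∧ P.totalDegree ≤ D ∧
      (mvPolyHeight P : ℝ) ≤ Real.exp ((D : ℝ) ^ β) ∧
      ∀ i : ℕ, i < 3 * ⌊(D : ℝ) ^ τ'⌋₊ → ‖aeval ![τ, (1 : ℂ)] (royD^[i] P)‖ ≤ Real.exp (-(D : ℝ) ^ ν))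

/-- … and Nguyen–Roy 2016 Thm 1 at the kernel point with rational translates `(2πi + ir, sⁱ)`. -/
def NguyenRoyAtKernelPoint : Prop :=
  ∀ (r s : ℚ), r ≠ 0 → s ≠ 0 → s ≠ 1 → s ≠ -1 →
    ∀ (σ β ν : ℝ), 1 ≤ σ → σ < 2 → σ + 1 < β →
    (3 / 2 ≤ σ → 2 + β - σ < ν) →
    (σ < 3 / 2 → 2 + β - σ + (σ - 1) * (3 - 2 * σ) / (2 + β - 2 * σ) < ν) →
    ¬ (∀ᶠ D : ℕ in atTop, ∃ P : MvPolynomial (Fin 2) ℤ, P ≠ 0 ∧ P.totalDegree ≤ D ∧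
      (mvPolyHeight P : ℝ) ≤ Real.exp ((D : ℝ) ^ β) ∧
      ∀ i : ℕ, i < 4 * ⌊(D : ℝ) ^ σ⌋₊ →
        ‖aeval ![τ + Complex.I * (r : ℂ) * (i : ℂ), (1 : ℂ) * (s : ℂ) ^ i] P‖ ≤ Real.exp (-(D : ℝ) ^ ν))

theorem roy2013AtKernelPoint_of (h : roy2013_thm_1_1)
    (hπ : Transcendental ℚ (τ : ℂ)) : Roy2013AtKernelPoint := by
  intro β τ' ν h1 h2 h3 h4 hhyp
  have := h τ 1 one_ne_zero β τ' ν h1 h2 h3 h4 hhyp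
  exact hπ this.1

end Summit.Schanuel.Schanuel.Cruxes.SchanuelOnLogFreeCore.KernelHelix

end
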